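import Mathlib
import HarnessLib
import Summits.HubbardSuperconductivity.HubbardSuperconductivity.Theorems.KLProgrammeH10TwoPointLimitKlAnisoAnchoredSectorCountThin
import Summits.HubbardSuperconductivity.HubbardSuperconductivity.Theorems.KLProgrammeKLRegimeSplitOnWindow

/-!
# Route `KLProgramme` — K3 engine child `KLRegimeEngineV17F2` (stmt-HubbardSuperconductivity-20437), stub (b) import ι₂:
# the log-free anchored anisotropic sector count ON THE COVARIANCE WINDOW `klWindowC`

Cell gate-hubbard-kl, plan g17 (R41)(i) «E1-P2-THIN-COUNT» (seat p4): the deliverable `card_bgmSectorSet_klAniso_anchored_le_linear`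
(`…KlAnisoAnchoredSectorCountThin`) read at the engine's level window `klWindowC = [-1.05, -0.15] ⊂ (-4, 0)` — the form the stub-(b) binders of
stmt-20437 consume (`μ ∈ klWindowC`, `FrameOK R U (nScales β) ν K`, `0 < c ≤ c₃`, `0 < U ≤ U₀`, `klBetaMin ≤ β ≤ e^{c/U²}`): ONE geometric constant
`C` (fixed before `R`), thresholds `c₃(R), U₀(R)`, and `#{Ω ∈ bgmSectorSet L M (klAnisoFamily L M β μ K klE0 n) 4 : Ω p = s} ≤ C · sectorCount n`
for every torus `L ≥ 1`, cutoff `M`, scale `n`, anchor leg `p` and label `s`.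

* **`card_bgmSectorSet_klAniso_anchored_le_linear_window`**.

Everything is PROVED; no definitions.  References: BGM 2006 §2.8 (2.73), (2.76)–(2.80), Lemma 3.1 [cite: BenfattoGiulianiMastropietro2006];
Mastropietro 2008 (14.67) [cite: Mastropietro2008].
-/

noncomputable section

namespace Summit.HubbardSuperconductivity.HubbardSuperconductivity.Theorems.PerturbedFermiCurve

set_option linter.dupNamespace false -- summit = problem name (single-conjunct summit), D-0017

open Classical
open Real Set Finset
open Literature.MathematicalPhysics.QuantumLattice Literature.MathematicalPhysics.QuantumLattice.BandSectorCounting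
open Literature.Probability.LatticeModels
open Summit.HubbardSuperconductivity.HubbardSuperconductivity.Theorems.DispersionFlow
open Summit.HubbardSuperconductivity.HubbardSuperconductivity.Theorems.KLRegimeSplit
open Summit.HubbardSuperconductivity.HubbardSuperconductivity.Theorems.KLProgrammeLegKernels

/-- **The log-free anchored anisotropic sector count on the covariance window `klWindowC`**: there is `C > 0` and, for every `R` with
`0 ≤ R.Gfr j`, thresholds `c₃, U₀ > 0` such that for all `0 < c ≤ c₃`, `0 < U ≤ U₀`, `klBetaMin ≤ β ≤ e^{c/U²}`, `μ ∈ klWindowC`, every frame with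
`FrameOK R U (nScales β) ν K`, every `L ≥ 1`, `M`, scale `n`, anchor leg `p` and anchor label `s`:
`#{Ω ∈ bgmSectorSet L M (klAnisoFamily L M β μ K klE0 n) 4 : Ω p = s} ≤ C · sectorCount n`.
[cite: BenfattoGiulianiMastropietro2006, §2.8 (2.73), (2.76)–(2.80), Lemma 3.1, App. A3] -/
theorem card_bgmSectorSet_klAniso_anchored_le_linear_window :
    ∃ C : ℝ, 0 < C ∧ ∀ R : RenConsts, (∀ j, 0 ≤ R.Gfr j) →
      ∃ c₃ : ℝ, 0 < c₃ ∧ ∃ U₀ : ℝ, 0 < U₀ ∧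
      ∀ c : ℝ, 0 < c → c ≤ c₃ → ∀ U : ℝ, 0 < U → U ≤ U₀ → ∀ β : ℝ, klBetaMin ≤ β → β ≤ Real.exp (c / U ^ 2) →
      ∀ μ ∈ klWindowC, ∀ (ν : ℝ) (K : TrigPolyC4v), FrameOK R U (nScales β) ν K →
      ∀ (L M : ℕ) [NeZero L] (n : ℕ) (p : Fin 4) (s : SectorLeg (sectorCount n)),
      ((((bgmSectorSet L M (klAnisoFamily L M β μ K klE0 n) 4).filter
          (fun Ω : Fin 4 → SectorLeg (sectorCount n) => Ω p = s)).card : ℕ) : ℝ) ≤ C * sectorCount n :=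
  card_bgmSectorSet_klAniso_anchored_le_linear (-1.05) (-0.15) (by norm_num) (by norm_num) (by norm_num)

end Summit.HubbardSuperconductivity.HubbardSuperconductivity.Theorems.PerturbedFermiCurve

end
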